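import Mathlib.Topology.MetricSpace.HausdorffDistance
import Mathlib.Topology.Metrizable.Basic
import Mathlib.Analysis.Complex.Basic
import HarnessLib

/-!
# Developing maps: the lattice Arzelà–Ascoli theorem (crux `BoundaryClosureR`,
stmt-CriticalPhenomena-14004, line `pick-half-plane`, stub `stub_developingMapsCompact`)

Support file (topic: an abstract Arzelà–Ascoli / diagonal-subsequence theorem for functions living
on a SEQUENCE OF POINT CLOUDS `S n` (embedded in `ℂ` by `π n`) rather than on a fixed space — the
form in which compactness of the normalised developing maps `h_δ = δ (H − H(s_b))/F(b)` of
Duminil-Copin–Smirnov 2012, §4, is used).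

`latticeArzelaAscoli`: let `U ⊆ ℂ`, clouds `S n : Set α` with embeddings `π n : α → ℂ` and values
`f n : α → ℂ`.  Assume, at every point `z ∈ U`,
* (EQ) asymptotic local equicontinuity: for some `η > 0` and every `ε > 0` there is `θ > 0` with,
  for all large `n`, `dist (f n s) (f n s') ≤ ε` whenever `s, s' ∈ S n` are embedded within `η` of
  `z` and within `θ` of each other;
* (BD) local boundedness: `‖f n s‖ ≤ B` for all large `n` and `s ∈ S n` embedded within `η` of `z`;
* (DS) density: for every `θ > 0` and all large `n` some point of `S n` is embedded within `θ`
  of `z`.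
Then along some subsequence `φ` the `f (φ i)` converge locally uniformly on `U` to a function `h`
continuous on `U`: for every compact `K ⊆ U` and `ε > 0`, for all large `i`,
`dist (f (φ i) s) (h (π (φ i) s)) < ε` for all `s ∈ S (φ i)` embedded in `K`.
Proof: countable dense subset of `U`, Tychonoff/diagonal extraction (`exists_subseq_forall_tendsto`),
Cauchy sequences at every point of `U`, the `ε/3` argument on compacts.
-/

noncomputable section

open scoped Topology
open Filter Set Metric

namespace Summit.CriticalPhenomena.SAWScalingLimit.Theorems.PickHalfPlane.DevelopingMaps

variable {α : Type*}

/-- **Diagonal extraction.**  Countably many eventually bounded complex sequences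
`n ↦ v n k` have a common subsequence along which every one of them converges (Tychonoff on
`Π_k closedBall 0 B_k` and sequential compactness of this first-countable compact set). [folklore] -/
theorem exists_subseq_forall_tendsto {ι : Type*} [Countable ι] (v : ℕ → ι → ℂ) (B : ι → ℝ)
    (hv : ∀ k, ∀ᶠ n in atTop, ‖v n k‖ ≤ B k) :
    ∃ φ : ℕ → ℕ, StrictMono φ ∧ ∃ a : ι → ℂ, ∀ k, Tendsto (fun i => v (φ i) k) atTop (𝓝 (a k)) := by
  classical
  set v' : ℕ → ι → ℂ := fun n k => if ‖v n k‖ ≤ B k then v n k else 0 with hv'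
  have hmem : ∀ n, v' n ∈ Set.pi univ (fun k => closedBall (0 : ℂ) (max (B k) 0)) := by
    intro n k _
    simp only [hv']
    split_ifs with h
    · exact mem_closedBall_zero_iff.2 (h.trans (le_max_left _ _))
    · exact mem_closedBall_zero_iff.2 (by rw [norm_zero]; exact le_max_right _ _)
  have hc : IsCompact (Set.pi univ (fun k => closedBall (0 : ℂ) (max (B k) 0))) :=
    isCompact_univ_pi fun k => isCompact_closedBall _ _
  obtain ⟨a, -, φ, hφ, hlim⟩ := hc.tendsto_subseq hmem
  refine ⟨φ, hφ, a, fun k => ?_⟩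
  have h1 : Tendsto (fun i => v' (φ i) k) atTop (𝓝 (a k)) := tendsto_pi_nhds.1 hlim k
  have h2 : ∀ᶠ i in atTop, v' (φ i) k = v (φ i) k :=
    (hφ.tendsto_atTop.eventually (hv k)).mono fun i hi => by simp only [hv', if_pos hi]
  exact h1.congr' h2

/-- **From density to approximating points.**  If for every `θ > 0`, for all large `n`, the cloud
`S n` has a point embedded within `θ` of `z`, then there is a choice `σ n ∈ S n` (for large `n`)
with `π n (σ n) → z`. [folklore] -/
theorem exists_seq_near [Nonempty α] {S : ℕ → Set α} {π : ℕ → α → ℂ} {z : ℂ}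
    (h : ∀ θ : ℝ, 0 < θ → ∀ᶠ n in atTop, ∃ s ∈ S n, dist (π n s) z < θ) :
    ∃ σ : ℕ → α, ∀ θ : ℝ, 0 < θ → ∀ᶠ n in atTop, σ n ∈ S n ∧ dist (π n (σ n)) z < θ := by
  classical
  have key : ∀ n : ℕ, ∃ s : α, ((π n '' S n).Nonempty →
      s ∈ S n ∧ dist (π n s) z < infDist z (π n '' S n) + 1 / ((n : ℝ) + 1)) := by
    intro n
    by_cases hne : (π n '' S n).Nonempty
    · have hpos : (0 : ℝ) < 1 / ((n : ℝ) + 1) := Nat.one_div_pos_of_nat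
      obtain ⟨y, ⟨s, hs, rfl⟩, hy⟩ :=
        (infDist_lt_iff hne).1 (show infDist z (π n '' S n) < infDist z (π n '' S n) + 1 / ((n : ℝ) + 1)
          by linarith)
      exact ⟨s, fun _ => ⟨hs, by rwa [dist_comm]⟩⟩
    · exact ⟨Classical.arbitrary α, fun h' => absurd h' hne⟩
  choose σ hσ using key
  refine ⟨σ, fun θ hθ => ?_⟩
  have h1 : ∀ᶠ n : ℕ in atTop, (1 : ℝ) / ((n : ℝ) + 1) < θ / 2 :=
    (tendsto_one_div_add_atTop_nhds_zero_nat).eventually (gt_mem_nhds (half_pos hθ))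
  filter_upwards [h (θ / 2) (half_pos hθ), h1] with n ⟨s, hs, hsd⟩ hn
  have hne : (π n '' S n).Nonempty := ⟨π n s, s, hs, rfl⟩
  obtain ⟨hσS, hσd⟩ := hσ n hne
  have h2 : infDist z (π n '' S n) ≤ dist z (π n s) := infDist_le_dist_of_mem ⟨s, hs, rfl⟩
  rw [dist_comm] at h2
  exact ⟨hσS, by linarith⟩

/-- **The lattice Arzelà–Ascoli theorem.**  See the module docstring: under asymptotic local
equicontinuity (EQ), local boundedness (BD) and density (DS) at every point of `U`, a subsequence
of the cloud functions `f n` converges locally uniformly on `U` to a function continuous on `U`.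
[cite: DuminilCopinSmirnov2012, §4 (precompactness of the maps H_δ)] -/
theorem latticeArzelaAscoli [Nonempty α] {U : Set ℂ} {S : ℕ → Set α} {π : ℕ → α → ℂ}
    {f : ℕ → α → ℂ}
    (hEQ : ∀ z ∈ U, ∃ η : ℝ, 0 < η ∧ ∀ ε : ℝ, 0 < ε → ∃ θ : ℝ, 0 < θ ∧ ∀ᶠ n in atTop,
      ∀ s ∈ S n, ∀ s' ∈ S n, dist (π n s) z < η → dist (π n s') z < η →
        dist (π n s) (π n s') < θ → dist (f n s) (f n s') ≤ ε)
    (hBD : ∀ z ∈ U, ∃ η : ℝ, 0 < η ∧ ∃ B : ℝ, ∀ᶠ n in atTop, ∀ s ∈ S n,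
      dist (π n s) z < η → ‖f n s‖ ≤ B)
    (hDS : ∀ z ∈ U, ∀ θ : ℝ, 0 < θ → ∀ᶠ n in atTop, ∃ s ∈ S n, dist (π n s) z < θ) :
    ∃ φ : ℕ → ℕ, StrictMono φ ∧ ∃ h : ℂ → ℂ, ContinuousOn h U ∧
      ∀ K : Set ℂ, IsCompact K → K ⊆ U → ∀ ε : ℝ, 0 < ε → ∀ᶠ i in atTop,
        ∀ s ∈ S (φ i), π (φ i) s ∈ K → dist (f (φ i) s) (h (π (φ i) s)) < ε := by
  classical
  ---------------------------------------------------------------- approximating points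
  have hσ' : ∀ z : ℂ, ∃ σ : ℕ → α, z ∈ U → ∀ θ : ℝ, 0 < θ → ∀ᶠ n in atTop,
      σ n ∈ S n ∧ dist (π n (σ n)) z < θ := by
    intro z
    by_cases hz : z ∈ U
    · obtain ⟨σ, hσ⟩ := exists_seq_near (hDS z hz)
      exact ⟨σ, fun _ => hσ⟩
    · exact ⟨fun _ => Classical.arbitrary α, fun h' => absurd h' hz⟩
  choose σ hσ using hσ'
  ---------------------------------------------------------------- the key local comparison
  have KL : ∀ z ∈ U, ∀ ε : ℝ, 0 < ε → ∃ ρ : ℝ, 0 < ρ ∧ ∀ᶠ n in atTop, σ z n ∈ S n ∧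
      dist (π n (σ z n)) z < ρ ∧ ∀ s ∈ S n, dist (π n s) z < ρ → dist (f n s) (f n (σ z n)) ≤ ε := by
    intro z hz ε hε
    obtain ⟨η, hη, hθ⟩ := hEQ z hz
    obtain ⟨θ, hθ0, hev⟩ := hθ ε hε
    have hρ : 0 < min (η / 2) (θ / 2) := lt_min (half_pos hη) (half_pos hθ0)
    refine ⟨min (η / 2) (θ / 2), hρ, ?_⟩
    filter_upwards [hev, hσ z hz _ hρ] with n hn ⟨hσS, hσd⟩
    refine ⟨hσS, hσd, fun s hs hsd => ?_⟩
    have h1 : dist (π n s) z < η :=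
      lt_of_lt_of_le hsd ((min_le_left _ _).trans (half_le_self hη.le))
    have h2 : dist (π n (σ z n)) z < η :=
      lt_of_lt_of_le hσd ((min_le_left _ _).trans (half_le_self hη.le))
    have h3 : dist (π n s) (π n (σ z n)) < θ := by
      calc dist (π n s) (π n (σ z n)) ≤ dist (π n s) z + dist (π n (σ z n)) z :=
            dist_triangle_right _ _ _
        _ < θ / 2 + θ / 2 :=
            add_lt_add (lt_of_lt_of_le hsd (min_le_right _ _)) (lt_of_lt_of_le hσd (min_le_right _ _))
        _ = θ := add_halves θ
    exact hn s hs (σ z n) hσS h1 h2 h3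
  ---------------------------------------------------------------- dense subset, extraction
  obtain ⟨Q, hQU, hQc, hUQ⟩ :=
    (TopologicalSpace.IsSeparable.of_separableSpace U).exists_countable_dense_subset
  haveI : Countable Q := hQc.to_subtype
  choose! ηB hηB B hB using hBD
  obtain ⟨φ, hφ, a, ha⟩ := exists_subseq_forall_tendsto (fun n (q : Q) => f n (σ q n))
    (fun q => B q) (fun q => by
      have hq : (q : ℂ) ∈ U := hQU q.2
      filter_upwards [hB q hq, hσ q hq (ηB q) (hηB q hq)] with n hn ⟨hS, hd⟩
      exact hn _ hS hd)
  have hφt := hφ.tendsto_atTop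
  ---------------------------------------------------------------- Cauchy at every point
  set w : ℂ → ℕ → ℂ := fun z i => f (φ i) (σ z (φ i)) with hw
  have KL' : ∀ z ∈ U, ∀ ε : ℝ, 0 < ε → ∃ ρ : ℝ, 0 < ρ ∧ ∀ᶠ i in atTop,
      σ z (φ i) ∈ S (φ i) ∧ dist (π (φ i) (σ z (φ i))) z < ρ ∧
      ∀ s ∈ S (φ i), dist (π (φ i) s) z < ρ → dist (f (φ i) s) (w z i) ≤ ε := by
    intro z hz ε hε
    obtain ⟨ρ, hρ, hev⟩ := KL z hz ε hε
    exact ⟨ρ, hρ, hφt.eventually hev⟩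
  have near : ∀ z ∈ U, ∀ ε : ℝ, 0 < ε → ∃ ρ : ℝ, 0 < ρ ∧ ∀ z' ∈ U, dist z' z < ρ →
      ∀ᶠ i in atTop, dist (w z' i) (w z i) ≤ ε := by
    intro z hz ε hε
    obtain ⟨ρ, hρ, hev⟩ := KL' z hz ε hε
    refine ⟨ρ / 2, half_pos hρ, fun z' hz' hd => ?_⟩
    filter_upwards [hev, hφt.eventually (hσ z' hz' (ρ / 2) (half_pos hρ))] with i ⟨_, _, hi⟩
      ⟨hS', hd'⟩
    refine hi _ hS' ?_
    calc dist (π (φ i) (σ z' (φ i))) z ≤ dist (π (φ i) (σ z' (φ i))) z' + dist z' z :=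
          dist_triangle _ _ _
      _ < ρ / 2 + ρ / 2 := add_lt_add hd' hd
      _ = ρ := add_halves ρ
  have cauchy : ∀ z ∈ U, CauchySeq (w z) := by
    intro z hz
    refine Metric.cauchySeq_iff.2 fun ε hε => ?_
    obtain ⟨ρ, hρ, hnear⟩ := near z hz (ε / 3) (by positivity)
    obtain ⟨q, hqQ, hqd⟩ := Metric.mem_closure_iff.1 (hUQ hz) ρ hρ
    rw [dist_comm] at hqd
    have hq := hnear q (hQU hqQ) hqd
    obtain ⟨N₁, hN₁⟩ := Metric.cauchySeq_iff.1 (ha ⟨q, hqQ⟩).cauchySeq (ε / 3) (by positivity)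
    obtain ⟨N₂, hN₂⟩ := eventually_atTop.1 hq
    refine ⟨max N₁ N₂, fun m hm n hn => ?_⟩
    have e1 : dist (w z m) (w q m) ≤ ε / 3 := by
      rw [dist_comm]; exact hN₂ m (le_of_max_le_right hm)
    have e2 : dist (w q m) (w q n) < ε / 3 :=
      hN₁ m (le_of_max_le_left hm) n (le_of_max_le_left hn)
    have e3 : dist (w q n) (w z n) ≤ ε / 3 := hN₂ n (le_of_max_le_right hn)
    calc dist (w z m) (w z n) ≤ dist (w z m) (w q m) + dist (w q m) (w q n) + dist (w q n) (w z n) :=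
          dist_triangle4 _ _ _ _
      _ < ε := by linarith
  ---------------------------------------------------------------- the limit and its continuity
  set h : ℂ → ℂ := fun z => limUnder atTop (w z) with hh
  have hlim : ∀ z ∈ U, Tendsto (w z) atTop (𝓝 (h z)) := fun z hz => (cauchy z hz).tendsto_limUnder
  have CM : ∀ z ∈ U, ∀ ε : ℝ, 0 < ε → ∃ ρ : ℝ, 0 < ρ ∧ ∀ z' ∈ U, dist z' z < ρ →
      dist (h z') (h z) ≤ ε := by
    intro z hz ε hε
    obtain ⟨ρ, hρ, hnear⟩ := near z hz ε hε
    exact ⟨ρ, hρ, fun z' hz' hd => le_of_tendsto ((hlim z' hz').dist (hlim z hz)) (hnear z' hz' hd)⟩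
  refine ⟨φ, hφ, h, ?_, ?_⟩
  · refine Metric.continuousOn_iff.2 fun z hz ε hε => ?_
    obtain ⟨ρ, hρ, hCM⟩ := CM z hz (ε / 2) (half_pos hε)
    exact ⟨ρ, hρ, fun z' hz' hd => lt_of_le_of_lt (hCM z' hz' hd) (half_lt_self hε)⟩
  ---------------------------------------------------------------- uniform convergence on compacts
  · intro K hK hKU ε hε
    have hε3 : 0 < ε / 3 := by positivity
    choose! ρ₁ hρ₁ hKL using fun z hz => KL' z hz (ε / 3) hε3
    choose! ρ₂ hρ₂ hCM using fun z hz => CM z hz (ε / 3) hε3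
    obtain ⟨t, htK, hcover⟩ := hK.elim_nhds_subcover (fun z => ball z (min (ρ₁ z) (ρ₂ z)))
      fun z hz => ball_mem_nhds z (lt_min (hρ₁ z (hKU hz)) (hρ₂ z (hKU hz)))
    have hev : ∀ᶠ i in atTop, ∀ z ∈ t, (σ z (φ i) ∈ S (φ i) ∧ dist (π (φ i) (σ z (φ i))) z < ρ₁ z ∧
        ∀ s ∈ S (φ i), dist (π (φ i) s) z < ρ₁ z → dist (f (φ i) s) (w z i) ≤ ε / 3) ∧
        dist (w z i) (h z) < ε / 3 := by
      refine (eventually_all_finset t).2 fun z hz => ?_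
      have hzU : z ∈ U := hKU (htK z hz)
      exact (hKL z hzU).and (Metric.tendsto_nhds.1 (hlim z hzU) _ hε3)
    filter_upwards [hev] with i hi s hs hsK
    obtain ⟨z, hzt, hzs⟩ := mem_iUnion₂.1 (hcover hsK)
    obtain ⟨⟨-, -, h1⟩, h2⟩ := hi z hzt
    have hzU : z ∈ U := hKU (htK z hzt)
    have hd : dist (π (φ i) s) z < min (ρ₁ z) (ρ₂ z) := mem_ball.1 hzs
    have e1 : dist (f (φ i) s) (w z i) ≤ ε / 3 := h1 s hs (lt_of_lt_of_le hd (min_le_left _ _))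
    have e3 : dist (h z) (h (π (φ i) s)) ≤ ε / 3 := by
      rw [dist_comm]; exact hCM z hzU _ (hKU hsK) (lt_of_lt_of_le hd (min_le_right _ _))
    calc dist (f (φ i) s) (h (π (φ i) s))
        ≤ dist (f (φ i) s) (w z i) + dist (w z i) (h z) + dist (h z) (h (π (φ i) s)) :=
          dist_triangle4 _ _ _ _
      _ < ε := by linarith

/-- **Registered piece `developingMapsCompact_latticeAA`** of stub `stub_developingMapsCompact` (crux
stmt-CriticalPhenomena-14004, line `pick-half-plane`): the lattice Arzelà–Ascoli theorem in
registry form (one `∀`-term; see `latticeArzelaAscoli`). [cite: DuminilCopinSmirnov2012, §4 (precompactness of the maps H_δ)] -/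
theorem developingMapsCompact_latticeAA : ∀ (α : Type) [Nonempty α] (U : Set ℂ) (S : ℕ → Set α) (emb : ℕ → α → ℂ) (f : ℕ → α → ℂ), (∀ z ∈ U, ∃ η : ℝ, 0 < η ∧ ∀ ε : ℝ, 0 < ε → ∃ θ : ℝ, 0 < θ ∧ ∀ᶠ n in Filter.atTop, ∀ s ∈ S n, ∀ s' ∈ S n, dist (emb n s) z < η → dist (emb n s') z < η → dist (emb n s) (emb n s') < θ → dist (f n s) (f n s') ≤ ε) → (∀ z ∈ U, ∃ η : ℝ, 0 < η ∧ ∃ B : ℝ, ∀ᶠ n in Filter.atTop, ∀ s ∈ S n, dist (emb n s) z < η → ‖f n s‖ ≤ B) → (∀ z ∈ U, ∀ θ : ℝ, 0 < θ → ∀ᶠ n in Filter.atTop, ∃ s ∈ S n, dist (emb n s) z < θ) → ∃ φ : ℕ → ℕ, StrictMono φ ∧ ∃ h : ℂ → ℂ, ContinuousOn h U ∧ ∀ K : Set ℂ, IsCompact K → K ⊆ U → ∀ ε : ℝ, 0 < ε → ∀ᶠ i in Filter.atTop, ∀ s ∈ S (φ i), emb (φ i) s ∈ K → dist (f (φ i)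 s) (h (emb (φ i) s)) < ε :=
  fun _ _ _ _ _ _ hEQ hBD hDS => latticeArzelaAscoli hEQ hBD hDS

end Summit.CriticalPhenomena.SAWScalingLimit.Theorems.PickHalfPlane.DevelopingMaps

end
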